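/-
Copyright (c) 2026 the pub-hodgecm-mathlib formalisation cell (harness21).  Prover seat hodgecm-mathlib-K2E3-p20 (g3), Track B «K2-LIT» ∕ h413,
line `K2_E3_EllipticInputs`, unit U12 «Characters», socket #11, road (11-SC), letter (SC-an) — brick (D0): THE HEIGHT-BALL COMPACT EXHAUSTION of a
`p`-adic unitary group (Harish-Chandra's `Ω_T = {1 + σ(x) < T}`), the common currency of the limit half (SC-lim∖ell) and the domination half (SC-dom).
Deal K2E3-plan (g2) 2026-09-04T01:04:01Z «then (D0) the shared height-ball `CompactExhaustion`».  2026-09-04.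
-/
import Literature.NumberTheory.Automorphic.UnitaryLatticeTreeLevelIndices          -- ★ `subgroupOf_glInt_eq_unitaryInt` (bridge `GL_N(𝒪) ∩ U = unitaryInt`); brings ★ `unitaryInt`, ★ `isCompact_generalLinearIntegral`, ★ `isClosed_unitaryGroupOfForm`
import Literature.NumberTheory.Automorphic.UnitaryThreeTorusDoubleCosetsHK          -- ★ `exists_v_pow_mul_le_one` (`|ϖ^M x| ≤ 1` for `M ≫ 0`)
import Literature.NumberTheory.Automorphic.SymplecticGroupHyperspecialGelfandPair    -- ★ `v_mul_apply_le_one` (integral × integral is integral)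
import Literature.NumberTheory.Automorphic.LocalUnitaryIntegralLevel                -- ★ `localIntegralLevel`, `mem_localIntegralLevel_iff_of_smul_eq`, ★ `localNonsplitEquiv`
import Literature.NumberTheory.Automorphic.AnisotropicUnitaryGroupCompactLocal      -- ★ `exists_v_eq_exp_neg_one_adicCompletion` (a uniformiser of `L_w`)
import Literature.NumberTheory.Automorphic.AdelicUnitaryGroupDatum                  -- ★ `cmDatum` (`(cmDatum L N H).Local v` IS `↥(«local» L c̄ N H v)`, `rfl`)
import Literature.NumberTheory.Automorphic.AdicCompletionCompact                    -- ★ `compactSpace_integer_adicCompletion`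
import HarnessLib

/-!
# K2_E3 road (h413 = stmt-HodgeConjecture-24833), unit U12, socket #11, road (11-SC), letter (SC-an) — brick (D0): THE HEIGHT-BALL COMPACT EXHAUSTION
# `Ω_m = {g : ‖g‖, ‖g⁻¹‖ ≤ q^m}` of `U(σ, H)(K)` and of `U_N(H)(L⁺_v)` (Harish-Chandra 1970, Part VII §2 p. 69: `‖xy‖ ≤ ‖x‖‖y‖`, `‖x‖ = 1 ⟺ x ∈ GL(n, 𝒪)`,
# `C_α` compact, every compact ⊆ some `C_α`)

Cell `pub/hodgecm-mathlib` (D-0151), Track B; letter **(SC-an)** `sig_K2E3SupercuspidalTruncatedCharAnalytic` (cand 3fdea465, r02 PASS), whose `Ω : CompactExhaustion G` is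
∃-bound and must carry BOTH the limit half [HC1970 Thm 20 uses right-`K₁`-invariance of `Ω_T`] and the domination half (★ p856355
`K2E3SupercuspidalTruncatedCharDominationOfBricks`).  `--supports stmt-HodgeConjecture-24833 --as helper`; THEOREMS ONLY — no `def`, no named fact, no
instance, no notation, no `sorry`.  Deal: K2E3-plan (g2) 01:04:01Z (D0).

THE OBJECT.  For `G ≤ GL_n(K)` over a discretely valued `K` with compact `𝒪` and a uniformiser `ϖ`, the HEIGHT BALLS
`Ω_m := {g ∈ G : ϖ^m g ∈ M_n(𝒪) ∧ ϖ^m g⁻¹ ∈ M_n(𝒪)}` (`= {1 + σ(g) ≤ m+1}` with `q^{σ(g)} = ‖g‖ := max_{ij}(|g_{ij}|, |(g⁻¹)_{ij}|)`) are compact OPEN, increasing,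
exhaust `G`, and satisfy `Ω_a · Ω_b ⊆ Ω_{a+b}`, `Ω_m⁻¹ = Ω_m`, `Ω_0 = K₁ := G ∩ GL_n(𝒪)` — hence every `Ω_m` is `K₁`-bi-invariant.  We package them as a Mathlib
`CompactExhaustion G` together with the membership characterisation (so the analytic bricks compute with entries) and the structural properties.
* §1 GENERIC over `K` with `Valued K ℤᵐ⁰`, `[CompactSpace 𝒪[K]]`, `σ : K →+* K` continuous, `H : Matrix n n K`, `G = ↥(unitaryGroupOfForm σ H)`:
  `isCompact_setOf_scaled_integral` (the `GL_n` ball is compact: closed embedding `Units.embedProduct` into `M_n × M_nᵐᵒᵖ` and the compact `ϖ^{−m}M_n(𝒪)`),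
  **`exists_heightBall_compactExhaustion`**.
* §2 THE CM DRESS at `G = (cmDatum L N H).Local v`, `v` NON-SPLIT, through the one-place model ★ `localNonsplitEquiv … w hw : G ≃ₜ* U(σ_w, H_w)(L_w)` and a uniformiser
  `ϖ` of `L_w`: **`exists_heightBall_compactExhaustion_cmDatum_local`** — membership read on `localNonsplitEquiv g`, `Ω 0 = localIntegralLevel` (★
  `mem_localIntegralLevel_iff_of_smul_eq` + ★ bridge `subgroupOf_glInt_eq_unitaryInt`).

HONEST LABEL: HC_CM is proved only modulo the 7 printed citations (2 remaining named inputs: hLiu418 = stmt-HodgeConjecture-24832, h413 =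
stmt-HodgeConjecture-24833) until rung 0 closes; count-neutral `--supports` helper (pure structure; nothing printed is asserted beyond HC's bookkeeping p. 69).

## References
* [HarishChandra1970] Harish-Chandra (notes by G. van Dijk), *Harmonic Analysis on Reductive p-adic Groups*, LNM 162 (1970), Part VII §2 p. 69 (`‖x‖`, `σ(x)`, `C_α`),
  §3 p. 70 (`Ω_T`).
* [PlatonovRapinchuk1994] V. Platonov, A. Rapinchuk, *Algebraic Groups and Number Theory* (1994), §3.3, §5.1 (`G_{𝒪_v} = G ∩ GL_n(𝒪_v)` compact open).
-/

set_option autoImplicit false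
-- the mandated namespace has the single-problem summit's repeated segment (`HodgeConjecture.HodgeConjecture`)
set_option linter.dupNamespace false

noncomputable section

open NumberField IsDedekindDomain Topology
open scoped Valued WithZero Matrix MatrixGroups
open Literature.NumberTheory.Automorphic Literature.NumberTheory.Automorphic.UnitaryGroup Literature.NumberTheory.Automorphic.HermitianLattice

namespace Summit.HodgeConjecture.HodgeConjecture.Cruxes.H413.K2E3HeightBallExhaustion

/-! ## §1 Generic: the height balls of `U(σ, H)(K) ≤ GL_n(K)` -/

section Generic

variable {K : Type*} [Field K] [Valued K ℤᵐ⁰] {n : Type*} [Fintype n] [DecidableEq n]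

/-- Scaled integrality is monotone in the exponent (`|ϖ| ≤ 1`). [cite: HarishChandra1970, Part VII §2 p. 69] -/
theorem v_pow_succ_mul_le_one {ϖ c : K} (hϖ : Valued.v ϖ ≤ 1) {m : ℕ} (h : Valued.v (ϖ ^ m * c) ≤ 1) :
    Valued.v (ϖ ^ (m + 1) * c) ≤ 1 := by
  rw [pow_succ', mul_assoc, map_mul]
  exact mul_le_one' hϖ h

omit [DecidableEq n] in
/-- **Submultiplicativity `‖xy‖ ≤ ‖x‖‖y‖`**: if `ϖ^a A` and `ϖ^b B` are integral then `ϖ^{a+b}(AB)` is integral. [cite: HarishChandra1970, Part VII §2 p. 69] -/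
theorem v_pow_add_mul_mul_apply_le_one {ϖ : K} {a b : ℕ} {A B : Matrix n n K}
    (hA : ∀ i j, Valued.v (ϖ ^ a * A i j) ≤ 1) (hB : ∀ i j, Valued.v (ϖ ^ b * B i j) ≤ 1) (i j : n) :
    Valued.v (ϖ ^ (a + b) * (A * B) i j) ≤ 1 := by
  have h := SymplecticCartan.v_mul_apply_le_one (A := (ϖ ^ a) • A) (B := (ϖ ^ b) • B)
    (fun i j => by rw [Matrix.smul_apply, smul_eq_mul]; exact hA i j) (fun i j => by rw [Matrix.smul_apply, smul_eq_mul]; exact hB i j) i j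
  rwa [Matrix.smul_mul, Matrix.mul_smul, smul_smul, Matrix.smul_apply, smul_eq_mul, ← pow_add] at h

omit [Fintype n] [DecidableEq n] in
/-- The integral matrices `{A : ∀ i j, |A_{ij}| ≤ 1} = M_n(𝒪)` form a compact subset of `M_n(K)` when `𝒪` is compact. [cite: PlatonovRapinchuk1994, §3.3] -/
theorem isCompact_setOf_forall_v_apply_le_one [CompactSpace 𝒪[K]] :
    IsCompact {A : Matrix n n K | ∀ i j, Valued.v (A i j) ≤ 1} := by
  have heq : {A : Matrix n n K | ∀ i j, Valued.v (A i j) ≤ 1} = Set.range (fun A : Matrix n n 𝒪[K] => A.map ((↑) : 𝒪[K] → K)) := by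
    ext A
    constructor
    · intro hA
      exact ⟨Matrix.of fun i j => ⟨A i j, (Valuation.mem_integer_iff _ _).2 (hA i j)⟩, by ext i j; rfl⟩
    · rintro ⟨B, rfl⟩ i j
      exact (Valuation.mem_integer_iff _ _).1 (B i j).2
  rw [heq]
  haveI : CompactSpace (Matrix n n 𝒪[K]) := inferInstanceAs (CompactSpace (n → n → 𝒪[K]))
  exact isCompact_range (continuous_id.matrix_map continuous_subtype_val)

omit [Fintype n] [DecidableEq n] in
/-- The scaled ball `{A : ∀ i j, |ϖ^m A_{ij}| ≤ 1} = ϖ^{−m} M_n(𝒪)` is compact (`ϖ ≠ 0`). [cite: HarishChandra1970, Part VII §2 p. 69] -/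
theorem isCompact_setOf_forall_v_pow_mul_apply_le_one [CompactSpace 𝒪[K]] {ϖ : K} (hϖ0 : ϖ ≠ 0) (m : ℕ) :
    IsCompact {A : Matrix n n K | ∀ i j, Valued.v (ϖ ^ m * A i j) ≤ 1} := by
  have hc : (ϖ ^ m) ≠ 0 := pow_ne_zero m hϖ0
  have heq : {A : Matrix n n K | ∀ i j, Valued.v (ϖ ^ m * A i j) ≤ 1} =
      (fun A : Matrix n n K => (ϖ ^ m)⁻¹ • A) '' {A : Matrix n n K | ∀ i j, Valued.v (A i j) ≤ 1} := by
    ext A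
    constructor
    · intro hA
      refine ⟨(ϖ ^ m) • A, fun i j => by rw [Matrix.smul_apply, smul_eq_mul]; exact hA i j, ?_⟩
      show (ϖ ^ m)⁻¹ • ((ϖ ^ m) • A) = A
      rw [smul_smul, inv_mul_cancel₀ hc, one_smul]
    · rintro ⟨B, hB, rfl⟩ i j
      show Valued.v (ϖ ^ m * ((ϖ ^ m)⁻¹ • B) i j) ≤ 1
      rw [Matrix.smul_apply, smul_eq_mul, ← mul_assoc, mul_inv_cancel₀ hc, one_mul]
      exact hB i j
  rw [heq]
  exact isCompact_setOf_forall_v_apply_le_one.image (continuous_const_smul _)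

/-- **The height ball of `GL_n(K)` is compact**: `{g : ϖ^m g ∈ M_n(𝒪) ∧ ϖ^m g⁻¹ ∈ M_n(𝒪)}` (Harish-Chandra's `C_α = {σ ≤ α}`), via the closed embedding
`g ↦ (g, g⁻¹)` of the units into `M_n × M_nᵐᵒᵖ` and the compact `ϖ^{−m}M_n(𝒪) × (ϖ^{−m}M_n(𝒪))ᵒᵖ`. [cite: HarishChandra1970, Part VII §2 p. 69] -/
theorem isCompact_setOf_scaled_integral [CompactSpace 𝒪[K]] {ϖ : K} (hϖ0 : ϖ ≠ 0) (m : ℕ) :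
    IsCompact {g : GL n K | (∀ i j, Valued.v (ϖ ^ m * (g : Matrix n n K) i j) ≤ 1) ∧
      ∀ i j, Valued.v (ϖ ^ m * ((g⁻¹ : GL n K) : Matrix n n K) i j) ≤ 1} := by
  set C : Set (Matrix n n K) := {A | ∀ i j, Valued.v (ϖ ^ m * A i j) ≤ 1} with hC
  have hCc : IsCompact C := isCompact_setOf_forall_v_pow_mul_apply_le_one hϖ0 m
  -- the image under `embedProduct` is the closed subset `{(a, b) : a b̄ = 1 = b̄ a}` of the compact `C × Cᵒᵖ`
  have hD : IsCompact ((C ×ˢ (MulOpposite.op '' C)) ∩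
      ({p : Matrix n n K × (Matrix n n K)ᵐᵒᵖ | p.1 * MulOpposite.unop p.2 = 1} ∩ {p | MulOpposite.unop p.2 * p.1 = 1})) := by
    refine (hCc.prod (hCc.image MulOpposite.continuous_op)).inter_right ?_
    exact (isClosed_eq (continuous_fst.mul (MulOpposite.continuous_unop.comp continuous_snd)) continuous_const).inter
      (isClosed_eq ((MulOpposite.continuous_unop.comp continuous_snd).mul continuous_fst) continuous_const)
  refine Units.isEmbedding_embedProduct.isCompact_iff.2 ?_
  have heq : (Units.embedProduct (Matrix n n K)) '' {g : GL n K | (∀ i j, Valued.v (ϖ ^ m * (g : Matrix n n K) i j) ≤ 1) ∧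
        ∀ i j, Valued.v (ϖ ^ m * ((g⁻¹ : GL n K) : Matrix n n K) i j) ≤ 1} =
      (C ×ˢ (MulOpposite.op '' C)) ∩
        ({p : Matrix n n K × (Matrix n n K)ᵐᵒᵖ | p.1 * MulOpposite.unop p.2 = 1} ∩ {p | MulOpposite.unop p.2 * p.1 = 1}) := by
    ext p
    constructor
    · rintro ⟨g, ⟨hg, hg'⟩, rfl⟩
      refine ⟨⟨hg, ⟨((g⁻¹ : GL n K) : Matrix n n K), hg', rfl⟩⟩, ?_, ?_⟩
      · change (g : Matrix n n K) * ((g⁻¹ : GL n K) : Matrix n n K) = 1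
        rw [← Units.val_mul, mul_inv_cancel, Units.val_one]
      · change ((g⁻¹ : GL n K) : Matrix n n K) * (g : Matrix n n K) = 1
        rw [← Units.val_mul, inv_mul_cancel, Units.val_one]
    · rintro ⟨⟨hp1, ⟨b, hb, hbp⟩⟩, hmul, hmul'⟩
      have hb' : MulOpposite.unop p.2 = b := by rw [← hbp, MulOpposite.unop_op]
      rw [Set.mem_setOf_eq, hb'] at hmul hmul'
      refine ⟨⟨p.1, b, hmul, hmul'⟩, ⟨hp1, hb⟩, ?_⟩
      change (p.1, MulOpposite.op b) = p
      rw [hbp]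
  rw [heq]
  exact hD

variable (σ : K →+* K) (H : Matrix n n K)

/-- **THE HEIGHT-BALL COMPACT EXHAUSTION OF `U(σ, H)(K)`** (Harish-Chandra's `Ω_T = {x : 1 + σ(x) ≤ T}`, `q^{σ(x)} = ‖x‖ = max(|x_{ij}|, |(x⁻¹)_{ij}|)`): for `σ`
continuous, `𝒪` compact and a uniformiser `ϖ` (`|ϖ| = exp(−1)`), there is a `CompactExhaustion Ω` of `G = ↥(unitaryGroupOfForm σ H)` with
(i) `g ∈ Ω m ↔ ϖ^m g` and `ϖ^m g⁻¹` integral; (ii) every `Ω m` OPEN; (iii) `Ω m⁻¹ = Ω m`; (iv) `Ω a · Ω b ⊆ Ω (a+b)` («`‖xy‖ ≤ ‖x‖‖y‖`»); (v) `Ω 0 = K₁ := U ∩ GL_n(𝒪)`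
(★ `unitaryInt`; so every `Ω m` is `K₁`-bi-invariant by (iv), «`‖x‖ = 1` iff `x ∈ GL(n, 𝒪)`»).  [cite: HarishChandra1970, Part VII §2 p. 69, §3 p. 70]
[cite: PlatonovRapinchuk1994, §3.3, §5.1] -/
theorem exists_heightBall_compactExhaustion [CompactSpace 𝒪[K]] (hσ : Continuous σ) {ϖ : K} (hϖ : Valued.v ϖ = WithZero.exp (-1 : ℤ)) :
    ∃ Ω : CompactExhaustion ↥(unitaryGroupOfForm σ H),
      (∀ (m : ℕ) (g : ↥(unitaryGroupOfForm σ H)), g ∈ Ω m ↔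
        (∀ i j, Valued.v (ϖ ^ m * ((g : GL n K) : Matrix n n K) i j) ≤ 1) ∧
          ∀ i j, Valued.v (ϖ ^ m * (((g : GL n K)⁻¹ : GL n K) : Matrix n n K) i j) ≤ 1) ∧
      (∀ m : ℕ, IsOpen (Ω m)) ∧
      (∀ (m : ℕ) (g : ↥(unitaryGroupOfForm σ H)), g ∈ Ω m → g⁻¹ ∈ Ω m) ∧
      (∀ (a b : ℕ) (g h : ↥(unitaryGroupOfForm σ H)), g ∈ Ω a → h ∈ Ω b → g * h ∈ Ω (a + b)) ∧
      (∀ g : ↥(unitaryGroupOfForm σ H), g ∈ Ω 0 ↔ g ∈ unitaryInt σ H) := by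
  have hϖ0 : ϖ ≠ 0 := by
    intro h; rw [h, map_zero] at hϖ; exact WithZero.zero_ne_coe hϖ
  have hϖ1 : Valued.v ϖ ≤ 1 := by rw [hϖ, ← WithZero.exp_zero, WithZero.exp_le_exp]; norm_num
  -- the balls as subsets of `G`
  let B : ℕ → Set ↥(unitaryGroupOfForm σ H) := fun m =>
    {g | (∀ i j, Valued.v (ϖ ^ m * ((g : GL n K) : Matrix n n K) i j) ≤ 1) ∧
      ∀ i j, Valued.v (ϖ ^ m * (((g : GL n K)⁻¹ : GL n K) : Matrix n n K) i j) ≤ 1}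
  have hBmem : ∀ m g, g ∈ B m ↔ (∀ i j, Valued.v (ϖ ^ m * ((g : GL n K) : Matrix n n K) i j) ≤ 1) ∧
      ∀ i j, Valued.v (ϖ ^ m * (((g : GL n K)⁻¹ : GL n K) : Matrix n n K) i j) ≤ 1 := fun m g => Iff.rfl
  -- compact: image in `GL n K` is the compact `GL`-ball met with the closed `U(σ, H)`
  have hBc : ∀ m, IsCompact (B m) := by
    intro m
    rw [Subtype.isCompact_iff]
    have heq : ((↑) : ↥(unitaryGroupOfForm σ H) → GL n K) '' B m =
        {g : GL n K | (∀ i j, Valued.v (ϖ ^ m * (g : Matrix n n K) i j) ≤ 1) ∧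
          ∀ i j, Valued.v (ϖ ^ m * ((g⁻¹ : GL n K) : Matrix n n K) i j) ≤ 1} ∩ (unitaryGroupOfForm σ H : Set (GL n K)) := by
      ext g
      constructor
      · rintro ⟨g', hg', rfl⟩
        exact ⟨hg', g'.2⟩
      · rintro ⟨hg, hgU⟩
        exact ⟨⟨g, hgU⟩, hg, rfl⟩
    rw [heq]
    exact (isCompact_setOf_scaled_integral hϖ0 m).inter_right (isClosed_unitaryGroupOfForm hσ H)
  -- open: entrywise conditions against the clopen `{|·| ≤ 1}`
  have hBo : ∀ m, IsOpen (B m) := by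
    intro m
    have hO : IsOpen {x : K | Valued.v x ≤ 1} := Valued.isOpen_integer K
    have hval : Continuous fun g : ↥(unitaryGroupOfForm σ H) => ((g : GL n K) : Matrix n n K) :=
      Units.continuous_val.comp continuous_subtype_val
    have hinv : Continuous fun g : ↥(unitaryGroupOfForm σ H) => (((g : GL n K)⁻¹ : GL n K) : Matrix n n K) :=
      Units.continuous_coe_inv.comp continuous_subtype_val
    have heq : B m = (⋂ i, ⋂ j, (fun g : ↥(unitaryGroupOfForm σ H) => ϖ ^ m * ((g : GL n K) : Matrix n n K) i j) ⁻¹' {x : K | Valued.v x ≤ 1}) ∩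
        ⋂ i, ⋂ j, (fun g : ↥(unitaryGroupOfForm σ H) => ϖ ^ m * (((g : GL n K)⁻¹ : GL n K) : Matrix n n K) i j) ⁻¹' {x : K | Valued.v x ≤ 1} := by
      ext g
      simp only [Set.mem_inter_iff, Set.mem_iInter, Set.mem_preimage, Set.mem_setOf_eq]
      exact hBmem m g
    rw [heq]
    exact (isOpen_iInter_of_finite fun i => isOpen_iInter_of_finite fun j =>
        hO.preimage (continuous_const.mul ((hval.matrix_elem i j)))).inter
      (isOpen_iInter_of_finite fun i => isOpen_iInter_of_finite fun j => hO.preimage (continuous_const.mul (hinv.matrix_elem i j)))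
  -- monotone
  have hBmono : ∀ m, B m ⊆ B (m + 1) := fun m g hg =>
    ⟨fun i j => v_pow_succ_mul_le_one hϖ1 (hg.1 i j), fun i j => v_pow_succ_mul_le_one hϖ1 (hg.2 i j)⟩
  -- exhaustive
  have hBcov : ∀ g : ↥(unitaryGroupOfForm σ H), ∃ m, g ∈ B m := by
    intro g
    choose N hN using fun p : n × n => exists_v_pow_mul_le_one hϖ (((g : GL n K) : Matrix n n K) p.1 p.2)
    choose N' hN' using fun p : n × n => exists_v_pow_mul_le_one hϖ ((((g : GL n K)⁻¹ : GL n K) : Matrix n n K) p.1 p.2)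
    refine ⟨Finset.univ.sup N + Finset.univ.sup N', fun i j => hN (i, j) _ ?_, fun i j => hN' (i, j) _ ?_⟩
    · exact (Finset.le_sup (Finset.mem_univ (i, j))).trans (Nat.le_add_right _ _)
    · exact (Finset.le_sup (Finset.mem_univ (i, j))).trans (Nat.le_add_left _ _)
  refine ⟨⟨B, hBc, fun m => ?_, ?_⟩, fun m g => Iff.rfl, hBo, fun m g hg => ?_, fun a b g h hg hh => ?_, fun g => ?_⟩
  · -- `Ω m ⊆ interior (Ω (m+1))`
    rw [(hBo (m + 1)).interior_eq]
    exact hBmono m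
  · exact Set.eq_univ_of_forall fun g => Set.mem_iUnion.2 (hBcov g)
  · -- inversion
    refine ⟨fun i j => ?_, fun i j => ?_⟩
    · rw [Subgroup.coe_inv]; exact hg.2 i j
    · rw [Subgroup.coe_inv, inv_inv]; exact hg.1 i j
  · -- products
    refine ⟨fun i j => ?_, fun i j => ?_⟩
    · rw [Subgroup.coe_mul, Units.val_mul]
      exact v_pow_add_mul_mul_apply_le_one hg.1 hh.1 i j
    · rw [Subgroup.coe_mul, _root_.mul_inv_rev, Units.val_mul, add_comm]
      exact v_pow_add_mul_mul_apply_le_one hh.2 hg.2 i j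
  · -- `Ω 0 = K₁`
    rw [mem_unitaryInt_iff]
    change g ∈ B 0 ↔ _
    simp only [hBmem, pow_zero, one_mul]

end Generic

/-! ## §2 The CM dress: the height balls of `U_N(H)(L⁺_v)` at a non-split place -/

section CM

variable (L : Type) [Field L] [NumberField L] [IsCMField L] (N : ℕ) (H : Matrix (Fin N) (Fin N) L)

/-- **THE HEIGHT-BALL COMPACT EXHAUSTION OF `G = U_N(H)(L⁺_v) = (cmDatum L N H).Local v` AT A NON-SPLIT PLACE** — read in the one-place model
`e := localNonsplitEquiv … w hw : G ≃ₜ* U(σ_w, H_w)(L_w)` with a uniformiser `ϖ` of `L_w`: a `CompactExhaustion Ω` of `G` with (i) `g ∈ Ω m ↔ ϖ^m (e g)` and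
`ϖ^m (e g)⁻¹` integral; (ii) every `Ω m` open; (iii) `Ω m⁻¹ = Ω m`; (iv) `Ω a · Ω b ⊆ Ω (a+b)`; (v) `Ω 0 = U_N(H)(𝒪_v)` (★ `localIntegralLevel`), so every `Ω m` is
bi-invariant under the compact open `U_N(H)(𝒪_v)` — the exhaustion along which both halves of (SC-an) are to be paid (HC's `Ω_T`, right-`K₁`-invariant as Theorem 20
needs). [cite: HarishChandra1970, Part VII §2 p. 69, §3 p. 70] [cite: PlatonovRapinchuk1994, §5.1] -/
theorem exists_heightBall_compactExhaustion_cmDatum_local (v : HeightOneSpectrum (𝓞 ↥(maximalRealSubfield L)))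
    (w : PlacesOver L v) (hw : IsCMField.complexConj L • w.1 = w.1) :
    ∃ (ϖ : w.1.adicCompletion L) (Ω : CompactExhaustion ((UnitaryGroup.cmDatum L N H).Local v)),
      Valued.v ϖ = WithZero.exp (-1 : ℤ) ∧
      (∀ (m : ℕ) (g : (UnitaryGroup.cmDatum L N H).Local v), g ∈ Ω m ↔
        (∀ i j, Valued.v (ϖ ^ m *
            (((localNonsplitEquiv (IsCMField.complexConj L) H (IsCMField.complexConj_ne_one L) w hw g :
                ↥(unitaryGroupOfForm (galAdicCompletionMap (L := L) (IsCMField.complexConj L) hw) (placeForm H w.1))) :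
              GL (Fin N) (w.1.adicCompletion L)) : Matrix (Fin N) (Fin N) (w.1.adicCompletion L)) i j) ≤ 1) ∧
          ∀ i j, Valued.v (ϖ ^ m *
            ((((localNonsplitEquiv (IsCMField.complexConj L) H (IsCMField.complexConj_ne_one L) w hw g :
                ↥(unitaryGroupOfForm (galAdicCompletionMap (L := L) (IsCMField.complexConj L) hw) (placeForm H w.1))) :
              GL (Fin N) (w.1.adicCompletion L))⁻¹ : GL (Fin N) (w.1.adicCompletion L)) : Matrix (Fin N) (Fin N) (w.1.adicCompletion L)) i j) ≤ 1) ∧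
      (∀ m : ℕ, IsOpen (Ω m)) ∧
      (∀ (m : ℕ) (g : (UnitaryGroup.cmDatum L N H).Local v), g ∈ Ω m → g⁻¹ ∈ Ω m) ∧
      (∀ (a b : ℕ) (g h : (UnitaryGroup.cmDatum L N H).Local v), g ∈ Ω a → h ∈ Ω b → g * h ∈ Ω (a + b)) ∧
      (∀ g : (UnitaryGroup.cmDatum L N H).Local v, g ∈ Ω 0 ↔ g ∈ localIntegralLevel (IsCMField.complexConj L) N H v) := by
  haveI := compactSpace_integer_adicCompletion L w.1
  obtain ⟨ϖ, hϖ⟩ := exists_v_eq_exp_neg_one_adicCompletion (E := L) w.1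
  set e : (UnitaryGroup.cmDatum L N H).Local v ≃ₜ*
      ↥(unitaryGroupOfForm (galAdicCompletionMap (L := L) (IsCMField.complexConj L) hw) (placeForm H w.1)) :=
    localNonsplitEquiv (IsCMField.complexConj L) H (IsCMField.complexConj_ne_one L) w hw with he
  obtain ⟨Ω, hmem, hopen, hinv, hmul, hzero⟩ := exists_heightBall_compactExhaustion
    (galAdicCompletionMap (L := L) (IsCMField.complexConj L) hw) (placeForm H w.1)
    (continuous_galAdicCompletionMap L (IsCMField.complexConj L) hw) hϖ
  -- pull the exhaustion back along the homeomorphism `e`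
  let Ω' : CompactExhaustion ((UnitaryGroup.cmDatum L N H).Local v) :=
    ⟨fun m => e ⁻¹' (Ω m), fun m => e.toHomeomorph.isCompact_preimage.2 (Ω.isCompact m), fun m => by
      have ho : IsOpen ((fun g : (UnitaryGroup.cmDatum L N H).Local v => e g) ⁻¹' (Ω (m + 1))) :=
        (hopen (m + 1)).preimage e.continuous
      change (fun g : (UnitaryGroup.cmDatum L N H).Local v => e g) ⁻¹' (Ω m) ⊆
        interior ((fun g : (UnitaryGroup.cmDatum L N H).Local v => e g) ⁻¹' (Ω (m + 1)))
      rw [ho.interior_eq]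
      exact Set.preimage_mono (Ω.subset_succ m), by
      rw [← Set.preimage_iUnion, Ω.iUnion_eq, Set.preimage_univ]⟩
  refine ⟨ϖ, Ω', hϖ, fun m g => hmem m (e g), fun m => (hopen m).preimage e.continuous, fun m g hg => ?_, fun a b g h hg hh => ?_, fun g => ?_⟩
  · change e g⁻¹ ∈ Ω m
    rw [map_inv]
    exact hinv m (e g) hg
  · change e (g * h) ∈ Ω (a + b)
    rw [map_mul]
    exact hmul a b (e g) (e h) hg hh
  · change e g ∈ Ω 0 ↔ _
    rw [hzero, ← UnitaryLatticeTree.subgroupOf_glInt_eq_unitaryInt, Subgroup.mem_subgroupOf]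
    exact (mem_localIntegralLevel_iff_of_smul_eq (IsCMField.complexConj L) N H (IsCMField.complexConj_ne_one L) w hw g).symm

end CM

end Summit.HodgeConjecture.HodgeConjecture.Cruxes.H413.K2E3HeightBallExhaustion

end
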